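import Literature.Algebra.Homology.AcyclicityLemmaRegularSequence
import Literature.Algebra.Homology.HomComplexOfModule
import Mathlib.Algebra.Module.Projective
import Mathlib.LinearAlgebra.FreeModule.Finite.Matrix
import Mathlib.RingTheory.Flat.Basic
import HarnessLib

/-!
# The dual of a finite free complex exact off the top degree is exact off the top (Mumford §13, duality-free)

Layer `Literature/Algebra/Homology`, namespace `Literature.Algebra.Homology`.  THEOREMS ONLY over ★ `AcyclicityLemmaRegularSequence`
(B1) and ★ `HomComplexOfModule` (`homComplex K M = Hom_R(K•, M)`, `(Hom)ⁱ = Hom(K^{-i}, M)`).  Brick B2 of the duality-free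
«H1-DIM any characteristic» cut of the DUAL-S road (cell hodgecm-mathlib, memo `MEMO-H1DIM-cut.v1.B-p04g40`).

* §1 `exists_partialHomotopy` — `K•` with PROJECTIVE terms, exact at every degree `< g`, and a scalar `φ` with `φ·H^g(K•) = 0`
  (`φ x ∈ im d` for `x ∈ K^g`): for every `j = g - n` there are `s : Kʲ → Kʲ⁻¹`, `s' : Kʲ⁺¹ → Kʲ` with `φ = d s + s' d` on `Kʲ`
  (descending induction, lifting `φ - s'd : Kʲ → ker d = im d` through the projective `Kʲ`).
* §2 `smul_cocycle_homComplex_mem_range` — hence `φ` kills every cohomology class of `Hom_R(K•, M)` for every module `M`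
  (`φ ψ = (ψ ∘ s') ∘ d` for a cocycle `ψ`), if moreover `Kⁱ = 0` for `i > g`.
* §3 **`homComplex_exactAt_of_isWeaklyRegular`** / `homComplex_exactAt_of_neg` — if `R` carries a weakly regular sequence
  `r_1, …, r_n`, `K•` has FINITE FREE terms, vanishes above `g`, is exact below `g`, and each `r_m` acts locally nilpotently on
  `H^g(K•)`, then `Hom_R(K•, R)` is exact at every degree `p < -g + n` (B1 applied to the dual, whose cohomology is killed by the
  `r_m^k` by §2); for `n ≥ g`: exact at all `p < 0`, i.e. `Hom(K^g,R) → … → Hom(K⁰,R)` is a finite free resolution of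
  `Q = H⁰(Hom(K•,R)) = coker(Hom(K¹,R) → Hom(K⁰,R))` — the module representing `M ↦ H⁰(K• ⊗ M)` ([EGAIII2] (7.7.6)).

This is the step of [MumfordAV1970] §13 where the Grothendieck complex `K•` of the Poincaré bundle over `R = 𝒪_{Â,0}` and its
dual are both shown to be resolutions; Mumford uses the hyperext spectral sequence `Ext^p(H^{-q}(K), 𝒪) ⇒ H^{p+q}(Hom(K, 𝒪))`, here
replaced by the explicit null-homotopy of §1 and the acyclicity lemma.  HC_CM is proved only modulo the 7 printed citations until
rung 0 closes; this file discharges none of them.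

## References
* [MumfordAV1970] D. Mumford, *Abelian Varieties* (1970), §13 (pp. 125–130).
* [PeskineSzpiro1973] C. Peskine, L. Szpiro, *Dimension projective finie et cohomologie locale*, Publ. Math. IHÉS 42 (1973), Lemme (1.8).
* [EGAIII2] A. Grothendieck, *EGA III₂* (1963), (7.7.6).
* [BrunsHerzog1998] W. Bruns, J. Herzog, *Cohen–Macaulay rings*, rev. ed. (1998), §1.1 (p. 4).
-/

universe v u

open CategoryTheory RingTheory.Sequence

namespace Literature.Algebra.Homology

variable {R : Type u} [CommRing R]



/-! ## §1 Partial null-homotopies of a scalar on a complex of projectives exact off the top degree -/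

section Homotopy

variable (K : CochainComplex (ModuleCat.{v} R) ℤ) (g : ℤ) (φ : R)

/-- `d ∘ d = 0` on elements (private helper). [folklore] -/
private theorem cochain_d_d_apply_aux (i j l : ℤ) (w : K.X i) : (K.d j l).hom ((K.d i j).hom w) = 0 := by
  rw [← ModuleCat.comp_apply, K.d_comp_d]
  rfl

/-- **A scalar killing the top cohomology of a complex of projectives exact off the top degree is null-homotopic, degree by degree.**
Let `K•` have projective terms, be exact at every degree `j < g`, and let `φ ∈ R` kill `H^g(K•) = K^g / im d` (`φ x ∈ im d^{g-1}` for all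
`x ∈ K^g`).  Then for every `n` and `j = g - n` there are `s : Kʲ → K^{j-1}`, `s' : K^{j+1} → Kʲ` with `φ = d s + s' d` on `Kʲ`
(descending induction: lift `φ - s' d`, which lands in `ker d = im d`, through the projective `Kʲ`).
[cite: MumfordAV1970, §13 (pp. 125–130)] [cite: BrunsHerzog1998, §1.1 (p. 4)] [cite: EGAIII2, (7.7.6)] -/
theorem exists_partialHomotopy (hproj : ∀ i, Module.Projective R (K.X i))
    (hex : ∀ (i j l : ℤ), i + 1 = j → j + 1 = l → j < g → Function.Exact (K.d i j).hom (K.d j l).hom)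
    (htop : ∀ i, i + 1 = g → ∀ x : K.X g, ∃ w : K.X i, φ • x = (K.d i g).hom w) :
    ∀ (n : ℕ) (i j l : ℤ), i + 1 = j → j + 1 = l → j = g - n →
      ∃ (s : K.X j →ₗ[R] K.X i) (s' : K.X l →ₗ[R] K.X j),
        ∀ x : K.X j, φ • x = (K.d i j).hom (s x) + s' ((K.d j l).hom x) := by
  intro n
  induction n with
  | zero =>
    intro i j l hij _ hj
    obtain rfl : j = g := by omega
    haveI := hproj j
    have hmem : ∀ x : K.X j, (φ • LinearMap.id (R := R) (M := K.X j)) x ∈ LinearMap.range (K.d i j).hom := fun x => by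
      obtain ⟨w, hw⟩ := htop i hij x
      exact ⟨w, hw.symm⟩
    obtain ⟨s, hs⟩ := Module.projective_lifting_property (K.d i j).hom.rangeRestrict
      (LinearMap.codRestrict _ (φ • LinearMap.id) hmem) (LinearMap.surjective_rangeRestrict _)
    refine ⟨s, 0, fun x => ?_⟩
    have := congrArg Subtype.val (LinearMap.congr_fun hs x)
    simp only [LinearMap.comp_apply, LinearMap.codRestrict_apply, LinearMap.smul_apply, LinearMap.id_apply] at this
    rw [LinearMap.zero_apply, add_zero, ← this]
  | succ n ih =>
    intro i j l hij hjl hj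
    obtain ⟨t, t', ht⟩ := ih j l (l + 1) hjl rfl (by omega)
    haveI := hproj j
    -- `φ - t d` lands in `ker d = im d`
    have hker : ∀ x : K.X j, (K.d j l).hom (φ • x - t ((K.d j l).hom x)) = 0 := fun x => by
      have h := ht ((K.d j l).hom x)
      rw [cochain_d_d_apply_aux, map_zero, add_zero] at h
      rw [map_sub, LinearMap.map_smul, ← h, sub_self]
    have hmem : ∀ x : K.X j, (φ • LinearMap.id - t ∘ₗ (K.d j l).hom : K.X j →ₗ[R] K.X j) x ∈
        LinearMap.range (K.d i j).hom := fun x => by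
      obtain ⟨w, hw⟩ := ((hex i j l hij hjl (by omega)) _).1 (hker x)
      exact ⟨w, hw⟩
    obtain ⟨s, hs⟩ := Module.projective_lifting_property (K.d i j).hom.rangeRestrict
      (LinearMap.codRestrict _ (φ • LinearMap.id - t ∘ₗ (K.d j l).hom) hmem) (LinearMap.surjective_rangeRestrict _)
    refine ⟨s, t, fun x => ?_⟩
    have := congrArg Subtype.val (LinearMap.congr_fun hs x)
    simp only [LinearMap.comp_apply, LinearMap.codRestrict_apply, LinearMap.sub_apply, LinearMap.smul_apply,
      LinearMap.id_apply] at this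
    rw [this, sub_add_cancel]

end Homotopy

/-! ## §2 The scalar kills the cohomology of `Hom(K•, M)` -/

section HomNilpotent

variable (K : CochainComplex (ModuleCat.{v} R) ℤ) (g : ℤ) (φ : R)

/-- **`φ` kills every cohomology class of `Hom_R(K•, M)`.**  Under the hypotheses of `exists_partialHomotopy` (projective terms, exact
below `g`, `φ H^g(K•) = 0`) and `Kⁱ = 0` for `i > g`: for every `R`-module `M` and every cocycle `ψ` of `Hom(K•, M)` (★ `homComplex`),
`φ ψ` is a coboundary — `φ ψ = ψ ∘ (d s + s' d) = (ψ ∘ s') ∘ d`.  (So `φ` annihilates `H•(Hom(K•, M))`; with `K•` a free resolution of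
`N = H^g(K•)` these are the `Ext•_R(N, M)`, without naming `Ext`.) [cite: MumfordAV1970, §13 (pp. 125–130)] [cite: EGAIII2, (7.7.6)]
[cite: BrunsHerzog1998, §1.1 (p. 4)] -/
theorem smul_cocycle_homComplex_mem_range (hproj : ∀ i, Module.Projective R (K.X i))
    (hex : ∀ (i j l : ℤ), i + 1 = j → j + 1 = l → j < g → Function.Exact (K.d i j).hom (K.d j l).hom)
    (htop : ∀ i, i + 1 = g → ∀ x : K.X g, ∃ w : K.X i, φ • x = (K.d i g).hom w)
    (hzero : ∀ i, g < i → Subsingleton (K.X i))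
    (M : Type v) [AddCommGroup M] [Module R M] (o p q : ℤ) (ho : o + 1 = p) (hq : p + 1 = q)
    (ψ : (homComplex K M).X p) (hψ : ((homComplex K M).d p q).hom ψ = 0) :
    ∃ χ : (homComplex K M).X o, φ • ψ = ((homComplex K M).d o p).hom χ := by
  change K.X (-p) →ₗ[R] M at ψ
  rw [homComplex_d_apply] at hψ
  change ψ ∘ₗ (K.d (-q) (-p)).hom = (0 : K.X (-q) →ₗ[R] M) at hψ
  by_cases hp : -p ≤ g
  · obtain ⟨n, hn⟩ : ∃ n : ℕ, -p = g - n := ⟨(g - -p).toNat, by rw [Int.toNat_of_nonneg (by omega)]; ring⟩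
    obtain ⟨s, s', hs⟩ := exists_partialHomotopy K g φ hproj hex htop n (-q) (-p) (-o) (by omega) (by omega) hn
    refine ⟨ψ ∘ₗ s', ?_⟩
    rw [homComplex_d_apply]
    have key : φ • ψ = (ψ ∘ₗ s') ∘ₗ (K.d (-p) (-o)).hom := by
      ext x
      have h0 : ψ ((K.d (-q) (-p)).hom (s x)) = 0 := by
        rw [← LinearMap.comp_apply, hψ, LinearMap.zero_apply]
      rw [LinearMap.smul_apply, ← LinearMap.map_smul, hs x, map_add, h0, zero_add, LinearMap.comp_apply,
        LinearMap.comp_apply]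
    exact key
  · haveI := hzero (-p) (by omega)
    refine ⟨0, ?_⟩
    have hψ0 : ψ = 0 := LinearMap.ext fun x => by rw [Subsingleton.elim x 0, map_zero, LinearMap.zero_apply]
    have key : φ • ψ = (0 : K.X (-p) →ₗ[R] M) := by rw [hψ0, smul_zero]
    rw [map_zero]
    exact key

end HomNilpotent

/-! ## §3 The dual `Hom_R(K•, R)` is exact off degree `0` -/

section DualAcyclic

variable {A : Type v} [CommRing A]

/-- Pointwise `r`-power torsion into a submodule of a finitely generated module is uniform (private helper). [folklore] -/
private theorem exists_pow_smul_mem_uniform {M : Type v} [AddCommGroup M] [Module A M] [Module.Finite A M]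
    (N : Submodule A M) (r : A) (h : ∀ x : M, ∃ k : ℕ, r ^ k • x ∈ N) : ∃ k : ℕ, ∀ x : M, r ^ k • x ∈ N := by
  classical
  obtain ⟨S, hS⟩ := Module.Finite.fg_top (R := A) (M := M)
  choose k hk using h
  refine ⟨S.sup k, fun x => ?_⟩
  have hx : x ∈ Submodule.span A (S : Set M) := by rw [hS]; exact Submodule.mem_top
  induction hx using Submodule.span_induction with
  | mem y hy =>
    have hle : k y ≤ S.sup k := Finset.le_sup hy
    rw [← Nat.sub_add_cancel hle, pow_add, mul_smul]
    exact N.smul_mem _ (hk y)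
  | zero => rw [smul_zero]; exact N.zero_mem
  | add y z _ _ hy hz => rw [smul_add]; exact N.add_mem hy hz
  | smul a y _ hy => rw [smul_comm]; exact N.smul_mem a hy

variable (K : CochainComplex (ModuleCat.{v} A) ℤ) (g : ℤ)

/-- **THE DUAL OF A FREE COMPLEX EXACT OFF THE TOP IS EXACT OFF THE TOP** ([MumfordAV1970] §13, the step «`Hom(K•, 𝒪)` is again
such a complex», here without duality or `Ext`).  Let `R` carry a weakly regular sequence `r_1, …, r_n`, and let `K•` be a cochain
complex of finite free `R`-modules with `Kⁱ = 0` for `i > g`, exact at every degree `j < g`, such that every `r_m` acts locally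
nilpotently on `H^g(K•) = K^g / im d`.  Then `Hom_R(K•, R)` (★ `homComplex K R`, degrees `≥ -g`) is exact at every degree
`p < -g + n`; for `n = g`: exact at all `p < 0`, i.e. `Hom(K^g,R) → … → Hom(K¹,R) → Hom(K⁰,R)` is a finite free RESOLUTION of
`Q := coker(Hom(K¹,R) → Hom(K⁰,R)) = H⁰(Hom(K•,R))`.  Proof: §2 (each `r_m^k` kills `H•(Hom(K•,R))`) feeds the acyclicity lemma ★
`exactAt_of_isWeaklyRegular_of_flat_of_locallyNilpotent`. [cite: MumfordAV1970, §13 (pp. 125–130)]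
[cite: PeskineSzpiro1973, Lemme (1.8)] [cite: EGAIII2, (7.7.6)] -/
theorem homComplex_exactAt_of_isWeaklyRegular (rs : List A) (hrs : IsWeaklyRegular A rs)
    (hfree : ∀ i, Module.Free A (K.X i)) (hfin : ∀ i, Module.Finite A (K.X i)) (hzero : ∀ i, g < i → Subsingleton (K.X i))
    (hex : ∀ (i j l : ℤ), i + 1 = j → j + 1 = l → j < g → Function.Exact (K.d i j).hom (K.d j l).hom)
    (hnil : ∀ r ∈ rs, ∀ i, i + 1 = g → ∀ x : K.X g, ∃ (k : ℕ) (w : K.X i), r ^ k • x = (K.d i g).hom w)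
    (p : ℤ) (hp : p < -g + rs.length) : (homComplex K A).ExactAt p := by
  have hproj : ∀ i, Module.Projective A (K.X i) := fun i => by haveI := hfree i; infer_instance
  refine exactAt_of_isWeaklyRegular_of_flat_of_locallyNilpotent (homComplex K A) rs hrs (-g) (fun i hi => ?_)
    (fun i => ?_) (fun r hr o p' q ho hq ψ hψ => ?_) p hp
  · haveI := hzero (-i) (by omega)
    exact inferInstanceAs (Subsingleton (K.X (-i) →ₗ[A] A))
  · haveI := hfree (-i); haveI := hfin (-i)
    exact inferInstanceAs (Module.Flat A (K.X (-i) →ₗ[A] A))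
  · -- a uniform exponent `k` with `r^k H^g(K•) = 0`
    haveI := hfin g
    obtain ⟨k, hk⟩ := exists_pow_smul_mem_uniform (LinearMap.range (K.d (g - 1) g).hom) r fun x => by
      obtain ⟨k, w, hw⟩ := hnil r hr (g - 1) (by omega) x
      exact ⟨k, w, hw.symm⟩
    have htop : ∀ i, i + 1 = g → ∀ x : K.X g, ∃ w : K.X i, r ^ k • x = (K.d i g).hom w := by
      intro i hi x
      obtain rfl : i = g - 1 := by omega
      obtain ⟨w, hw⟩ := hk x
      exact ⟨w, hw.symm⟩
    obtain ⟨χ, hχ⟩ := smul_cocycle_homComplex_mem_range K g (r ^ k) hproj hex htop hzero A o p' q ho hq ψ hψ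
    exact ⟨k, χ, hχ⟩

/-- **Corollary (`n = g`)**: with a weakly regular sequence of length `g` (e.g. a regular system of parameters of a regular local
ring of dimension `g`), `Hom_R(K•, R)` is exact at every degree `p < 0`. [cite: MumfordAV1970, §13 (pp. 125–130)]
[cite: PeskineSzpiro1973, Lemme (1.8)] -/
theorem homComplex_exactAt_of_neg (rs : List A) (hrs : IsWeaklyRegular A rs) (hlen : (g : ℤ) ≤ rs.length)
    (hfree : ∀ i, Module.Free A (K.X i)) (hfin : ∀ i, Module.Finite A (K.X i)) (hzero : ∀ i, g < i → Subsingleton (K.X i))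
    (hex : ∀ (i j l : ℤ), i + 1 = j → j + 1 = l → j < g → Function.Exact (K.d i j).hom (K.d j l).hom)
    (hnil : ∀ r ∈ rs, ∀ i, i + 1 = g → ∀ x : K.X g, ∃ (k : ℕ) (w : K.X i), r ^ k • x = (K.d i g).hom w)
    (p : ℤ) (hp : p < 0) : (homComplex K A).ExactAt p :=
  homComplex_exactAt_of_isWeaklyRegular K g rs hrs hfree hfin hzero hex hnil p (by omega)

end DualAcyclic


end Literature.Algebra.Homology
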